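import Literature.NumberTheory.EllipticCurves.HeightConductorBoundsPropTenEightProofs
import Literature.NumberTheory.Multiplicative.DivisorFunctionMaximalOrder
import Mathlib.Analysis.SpecialFunctions.Log.Monotone
import HarnessLib

/-!
# von Känel–Matschke, Prop. 10.8 (iii) — PROVED:
# `β ≤ (1/8) ν log N + ((1/6) log 2 + o(1)) ν log N / log log N`

Topic `Literature/NumberTheory/EllipticCurves` (family `abc`, LADDER-ABC A1: the *modular method*).
A proofs-only companion (theorems only; NO definition, NO new named fact, nothing restated; D-0026)
of `HeightConductorBoundsModularity.lean`: the named fact `vonKanelMatschke_prop_10_8_iii` —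
R. von Känel, B. Matschke, arXiv:1605.06079 = Mem. AMS **286** (2023) no. 1419
[`VonkanelMatschke2023`], **Prop. 10.8 (iii)**: *"If `N → ∞` then
`β ≤ (1/8) ν log N + ((1/6) log 2 + o(1))/(log log N) · ν log N`"* (typed with `o(1)` rendered as
`∀ δ > 0 ∃ N₀`) — is DISCHARGED: `vonKanelMatschke_prop_10_8_iii_holds`.

## The proof (printed proof of §10.5.3, over the tree)

*"To show (iii) … Wigert's bound gives `log τ(n) ≤ (log 2 + o(1)) log n / log log n`. This implies
that `Σ_{j∈J} log τ(j) ≤ m (log 2 + o(1)) log l / log log l` … Therefore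
`β ≤ m(½ log m + ½ log l + (log 2 + o(1)) log l / log log l)`. Then … the above estimates for `m`
and `l`, given in (eq:martinbound) and (eq:lbound) respectively, lead to statement (iii)."*
Over the tree: Wigert's bound is the THEOREM
`Literature.NumberTheory.Multiplicative.DivisorMaximalOrder.eventually_log_card_divisors_le`
(Hardy–Wright Thm. 317, upper half); it is made uniform on `1 ≤ j ≤ l` through `τ(j) ≤ j` for the
finitely many small `j` and the monotonicity of `x / log x` on `[e, ∞)` (Mathlib's
`Real.log_div_self_antitoneOn`) (`exists_log_card_divisors_le_uniform`); (eq:martinbound) is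
`twelve_mul_newformCount_le` and, in place of (eq:lbound), `log l ≤ 2 log N + log log N`
(`log_vkmIndexL_le`, from the CLMS-based bounds of `HeightConductorBoundsExplicitInputsProofs`).
With `W = log N / log log N` the printed bookkeeping reads
`β ≤ (ν+1)/12 · ((3/2) log N + ½ log log N + 2(1+ε) log 2 · W + K)`, and the lower-order terms are
`o(ν log N / log log N)` by `(log log N)² = o(log N)` and `log N = o(N)` (Mathlib's
`Real.isLittleO_pow_log_id_atTop`, `Real.isLittleO_log_id_atTop`), `ν ≥ N/2` (`half_le_condNu`).

No `abc` claim; typed ≠ endorsed. All theorems; axioms standard.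

## References
* R. von Känel, B. Matschke, arXiv:1605.06079 (2016) = Mem. AMS 286 (2023), Prop. 10.8 (iii), §10.5.3. [VonkanelMatschke2023]
* G. H. Hardy, E. M. Wright, *An Introduction to the Theory of Numbers*, 6th ed. (2008), Thm. 317 (Wigert). [HardyWright2008]
-/

noncomputable section

open Finset Real Filter Topology Asymptotics
namespace Literature.NumberTheory.EllipticCurves.ModularForms

/-! ### 1. The `τ`-sum under a general bound on `log τ` -/
/-- If `log τ(j) ≤ T` for all `1 ≤ j ≤ l` (`l ≥ 1`, `T ≥ 0`), then
`max_{J ⊆ {1,…,l}, |J| ≤ m} Σ_{j∈J} log(τ(j) j^{1/2}) ≤ m (T + ½ log l)` — the printed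
"`Σ_{j∈J} log τ(j) ≤ m · (…)`" step with the `j^{1/2}` bookkeeping.
[cite: VonkanelMatschke2023, §10.5.3 (proof of Prop. 10.8 (iii))] -/
theorem maxLogTauSum_le_of_log_card_divisors_le {l : ℕ} (hl : 1 ≤ l) {T : ℝ} (hT : 0 ≤ T)
    (hτ : ∀ j : ℕ, 1 ≤ j → j ≤ l → Real.log (j.divisors.card : ℝ) ≤ T) (m : ℕ) :
    maxLogTauSum l m ≤ m * (T + 1 / 2 * Real.log l) := by
  unfold maxLogTauSum
  refine Finset.sup'_le _ _ fun J hJ ↦ ?_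
  obtain ⟨hJsub, hJcard⟩ := Finset.mem_filter.mp hJ
  rw [Finset.mem_powerset] at hJsub
  have hB : 0 ≤ T + 1 / 2 * Real.log l := by
    have := Real.log_nonneg (show (1 : ℝ) ≤ l by exact_mod_cast hl); positivity
  have hterm : ∀ j ∈ J, Real.log ((j.divisors.card : ℝ) * Real.sqrt j) ≤ T + 1 / 2 * Real.log l := by
    intro j hj
    obtain ⟨hj1, hjl⟩ := Finset.mem_Icc.mp (hJsub hj)
    have hj' : (1 : ℝ) ≤ j := by exact_mod_cast hj1
    have hjl' : (j : ℝ) ≤ l := by exact_mod_cast hjl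
    have hτ1 : (1 : ℝ) ≤ (j.divisors.card : ℝ) := by
      exact_mod_cast Finset.card_pos.mpr ⟨1, Nat.one_mem_divisors.mpr (by omega)⟩
    rw [Real.log_mul (by positivity) (by positivity), Real.log_sqrt (by positivity)]
    have h1 := hτ j hj1 hjl
    have h2 : Real.log j ≤ Real.log l := Real.log_le_log (by positivity) hjl'
    linarith
  calc ∑ j ∈ J, Real.log ((j.divisors.card : ℝ) * Real.sqrt j)
      ≤ ∑ _j ∈ J, (T + 1 / 2 * Real.log l) := Finset.sum_le_sum hterm
    _ = J.card * (T + 1 / 2 * Real.log l) := by rw [Finset.sum_const, nsmul_eq_mul]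
    _ ≤ m * (T + 1 / 2 * Real.log l) := mul_le_mul_of_nonneg_right (by exact_mod_cast hJcard) hB

/-! ### 2. Wigert's bound, uniformly on `1 ≤ j ≤ l` -/
/-- `log 16 ≥ e`, so `log x ≥ e` for `x ≥ 16`. [folklore] -/
private theorem exp_one_le_log {x : ℝ} (hx : 16 ≤ x) : Real.exp 1 ≤ Real.log x := by
  have h16 : Real.log 16 ≤ Real.log x := Real.log_le_log (by norm_num) hx
  rw [show (16 : ℝ) = 2 ^ 4 by norm_num, Real.log_pow] at h16
  push_cast at h16
  have := Real.exp_one_lt_d9; have := Real.log_two_gt_d9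
  linarith

/-- `x ↦ x / log x` is monotone on `[e, ∞)` (Mathlib: `log x / x` is antitone there). [folklore] -/
private theorem div_log_mono {x y : ℝ} (hx : Real.exp 1 ≤ x) (hxy : x ≤ y) :
    x / Real.log x ≤ y / Real.log y := by
  have hy : Real.exp 1 ≤ y := hx.trans hxy
  have hxpos : 0 < x := (Real.exp_pos 1).trans_le hx
  have hypos : 0 < y := (Real.exp_pos 1).trans_le hy
  have hlx : 1 ≤ Real.log x := by rwa [Real.le_log_iff_exp_le hxpos]
  have hly : 1 ≤ Real.log y := by rwa [Real.le_log_iff_exp_le hypos]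
  have h : Real.log y / y ≤ Real.log x / x := Real.log_div_self_antitoneOn hx hy hxy
  rw [div_le_div_iff₀ hypos hxpos] at h
  rw [div_le_div_iff₀ (by linarith) (by linarith)]
  linarith

/-- **Wigert's bound, uniform version** (Hardy–Wright Thm. 317, upper half, PROVED in the tree as
`DivisorMaximalOrder.eventually_log_card_divisors_le`): for `ε > 0` there is `l₀ ≥ 16` such that for
all `l ≥ l₀` and all `1 ≤ j ≤ l`, `log τ(j) ≤ (1+ε) log 2 · log l / log log l + log l₀` (small `j`:
`τ(j) ≤ j < l₀`; large `j`: Wigert at `j` and `log j / log log j ≤ log l / log log l`).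
[cite: HardyWright2008, Thm 317 (§18.1)] -/
theorem exists_log_card_divisors_le_uniform {ε : ℝ} (hε : 0 < ε) :
    ∃ l₀ : ℕ, 16 ≤ l₀ ∧ ∀ l : ℕ, l₀ ≤ l → ∀ j : ℕ, 1 ≤ j → j ≤ l →
      Real.log (j.divisors.card : ℝ) ≤
        (1 + ε) * Real.log 2 * Real.log l / Real.log (Real.log l) + Real.log l₀ := by
  obtain ⟨n₀, hn₀⟩ := Filter.eventually_atTop.mp
    (Literature.NumberTheory.Multiplicative.DivisorMaximalOrder.eventually_log_card_divisors_le hε)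
  refine ⟨max n₀ 16, le_max_right _ _, fun l hl j hj1 hjl ↦ ?_⟩
  have hl16 : (16 : ℝ) ≤ l := by exact_mod_cast (le_max_right n₀ 16).trans hl
  have hlog2 : 0 < Real.log 2 := Real.log_pos (by norm_num)
  have he := Real.exp_one_gt_d9
  have hlogl : Real.exp 1 ≤ Real.log l := exp_one_le_log hl16
  have hll : 0 < Real.log (Real.log l) := Real.log_pos (by linarith)
  have hmain : 0 ≤ (1 + ε) * Real.log 2 * Real.log l / Real.log (Real.log l) := by positivity
  have hl0' : (1 : ℝ) ≤ ((max n₀ 16 : ℕ) : ℝ) := by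
    exact_mod_cast le_trans (by norm_num) (le_max_right n₀ 16)
  have hl0log : 0 ≤ Real.log ((max n₀ 16 : ℕ) : ℝ) := Real.log_nonneg hl0'
  have hj' : (1 : ℝ) ≤ j := by exact_mod_cast hj1
  have hτ1 : (1 : ℝ) ≤ (j.divisors.card : ℝ) := by
    exact_mod_cast Finset.card_pos.mpr ⟨1, Nat.one_mem_divisors.mpr (by omega)⟩
  by_cases hj : j < max n₀ 16
  · -- small `j`: `log τ(j) ≤ log j ≤ log l₀`
    have hτ : (j.divisors.card : ℝ) ≤ j := by exact_mod_cast Nat.card_divisors_le_self j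
    have h1 : Real.log (j.divisors.card : ℝ) ≤ Real.log j := Real.log_le_log (by linarith) hτ
    have h2 : Real.log j ≤ Real.log ((max n₀ 16 : ℕ) : ℝ) :=
      Real.log_le_log (by linarith) (by exact_mod_cast hj.le)
    linarith
  · -- large `j`: Wigert at `j`, then monotonicity of `x / log x`
    rw [not_lt] at hj
    have hW := hn₀ j ((le_max_left _ _).trans hj)
    have hj16 : (16 : ℝ) ≤ j := by exact_mod_cast (le_max_right n₀ 16).trans hj
    have hlogj : Real.exp 1 ≤ Real.log j := exp_one_le_log hj16
    have hjl' : Real.log j ≤ Real.log l := Real.log_le_log (by linarith) (by exact_mod_cast hjl)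
    have hmono := div_log_mono hlogj hjl'
    have h3 : (1 + ε) * Real.log 2 * Real.log j / Real.log (Real.log j) ≤
        (1 + ε) * Real.log 2 * Real.log l / Real.log (Real.log l) := by
      rw [mul_div_assoc, mul_div_assoc]
      exact mul_le_mul_of_nonneg_left hmono (by positivity)
    linarith

/-! ### 3. `log l ≤ 2 log N + log log N` and `l ≥ N/2` -/
/-- `l ≥ ⌊N/2⌋` (`N ∏_{p∣N}(p+1) ≥ 3N` for `N ≥ 2`). [cite: VonkanelMatschke2023, §10.5.1 (def:bb*)] -/
theorem half_le_vkmIndexL {N : ℕ} (hN : 2 ≤ N) : N / 2 ≤ vkmIndexL N := by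
  unfold vkmIndexL
  obtain ⟨q, hq⟩ : N.primeFactors.Nonempty := Nat.nonempty_primeFactors.mpr (by omega)
  have hq2 : 2 ≤ q := (Nat.prime_of_mem_primeFactors hq).two_le
  have h3 : 3 ≤ ∏ p ∈ N.primeFactors, (p + 1) := by
    rw [← Finset.mul_prod_erase _ _ hq]
    have hne : ∏ p ∈ N.primeFactors.erase q, (p + 1) ≠ 0 :=
      Finset.prod_ne_zero_iff.mpr fun p _ ↦ Nat.succ_ne_zero p
    have h1 : 1 ≤ ∏ p ∈ N.primeFactors.erase q, (p + 1) := Nat.one_le_iff_ne_zero.mpr hne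
    nlinarith
  rw [Nat.le_div_iff_mul_le (by norm_num)]
  have := Nat.div_mul_le_self N 2
  nlinarith

/-- **`log l ≤ 2 log N + log log N`** for `N ≥ 11` (in place of the printed (eq:lbound)): from
`l ≤ (e^γ/6) N² log log N` (`γ < log 6`, `log log log N ≤ log log N`) resp. `l ≤ (2/5) N²`.
[cite: VonkanelMatschke2023, §10.5.3 (eq:lbound)] -/
theorem log_vkmIndexL_le {N : ℕ} (hN : 11 ≤ N) :
    Real.log (vkmIndexL N) ≤ 2 * Real.log N + Real.log (Real.log N) := by
  have hN2 : 2 ≤ N := by omega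
  have hN' : (11 : ℝ) ≤ N := by exact_mod_cast hN
  have hl1 : 1 ≤ vkmIndexL N := one_le_vkmIndexL hN2
  have hlpos : (0 : ℝ) < vkmIndexL N := by exact_mod_cast hl1
  -- `log N > 2`, `log log N > 0`
  have hL : 2 < Real.log N := by
    rw [Real.lt_log_iff_exp_lt (by linarith), show (2 : ℝ) = 1 + 1 by norm_num, Real.exp_add]
    have h := Real.exp_one_lt_d9
    have := mul_lt_mul'' h h (Real.exp_pos 1).le (Real.exp_pos 1).le
    linarith
  have hL2 : 0 < Real.log (Real.log N) := Real.log_pos (by linarith)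
  by_cases hrad : ∏ p ∈ N.primeFactors, p ∈ ({2, 3, 5, 6, 10, 30} : Finset ℕ)
  · have h := vkmIndexL_le_of_rad_mem (by omega) hrad
    have h2 := Real.log_le_log hlpos h
    rw [Real.log_mul (by norm_num) (by positivity), Real.log_pow,
      Real.log_div (by norm_num) (by norm_num)] at h2
    push_cast at h2
    have := Real.log_two_lt_d9; have := Real.log_five_gt_d9
    linarith
  · have h := vkmIndexL_le_of_rad_not_mem hN2 hrad
    have h2 := Real.log_le_log hlpos h
    rw [Real.log_mul (by positivity) hL2.ne', Real.log_mul (by positivity) (by positivity),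
      Real.log_div (by positivity) (by norm_num), Real.log_exp, Real.log_pow] at h2
    push_cast at h2
    have hγ := Literature.Analysis.SpecialFunctions.Real.eulerMascheroniConstant_lt_d8
    have h6 : (1.7917594 : ℝ) ≤ Real.log 6 := by
      rw [show (6 : ℝ) = 2 * 3 by norm_num, Real.log_mul (by norm_num) (by norm_num)]
      have := Real.log_two_gt_d9; have := Real.log_three_gt_d9
      linarith
    have hL3 : Real.log (Real.log (Real.log N)) ≤ Real.log (Real.log N) - 1 :=
      Real.log_le_sub_one_of_pos hL2
    linarith

/-! ### 4. The eventual (in `N`) analytic inequalities -/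
/-- The lower-order terms are eventually small: for `δ, C, D > 0`, eventually in `N`:
`N ≥ 11`, `N ≥ D`, `log log N ≥ 1`, `(log log N)² ≤ 6δ log N`, `C log log N ≤ 3δ log N`,
`(1/8 + log 2/6 + δ) log N ≤ N/2`. [folklore] -/
private theorem eventually_aux {δ C D : ℝ} (hδ : 0 < δ) (hC : 0 < C) :
    ∀ᶠ N : ℕ in atTop, 11 ≤ N ∧ D ≤ (N : ℝ) ∧ 1 ≤ Real.log (Real.log N) ∧
      Real.log (Real.log N) ^ 2 ≤ 6 * δ * Real.log N ∧
      C * Real.log (Real.log N) ≤ 3 * δ * Real.log N ∧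
      (1 / 8 + Real.log 2 / 6 + δ) * Real.log N ≤ (N : ℝ) / 2 := by
  have hcast : Tendsto (fun N : ℕ ↦ (N : ℝ)) atTop atTop := tendsto_natCast_atTop_atTop
  have hL : Tendsto (fun N : ℕ ↦ Real.log N) atTop atTop := Real.tendsto_log_atTop.comp hcast
  have hL2 : Tendsto (fun N : ℕ ↦ Real.log (Real.log N)) atTop atTop :=
    Real.tendsto_log_atTop.comp hL
  -- `(log log N)² = o(log N)`, `log log N = o(log N)`, `log N = o(N)`
  have h1 : (fun N : ℕ ↦ Real.log (Real.log N) ^ 2) =o[atTop] fun N : ℕ ↦ Real.log (N : ℝ) :=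
    (Real.isLittleO_pow_log_id_atTop (n := 2)).comp_tendsto hL
  have h2 : (fun N : ℕ ↦ Real.log (Real.log N)) =o[atTop] fun N : ℕ ↦ Real.log (N : ℝ) :=
    Real.isLittleO_log_id_atTop.comp_tendsto hL
  have h3 : (fun N : ℕ ↦ Real.log (N : ℝ)) =o[atTop] fun N : ℕ ↦ (N : ℝ) :=
    Real.isLittleO_log_id_atTop.comp_tendsto hcast
  have hc3 : 0 < 1 / 8 + Real.log 2 / 6 + δ := by
    have := Real.log_two_gt_d9; positivity
  filter_upwards [eventually_ge_atTop 11, hcast.eventually_ge_atTop D, hL2.eventually_ge_atTop 1,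
    hL.eventually_ge_atTop 0, (Asymptotics.isLittleO_iff.mp h1) (show (0 : ℝ) < 6 * δ by positivity),
    (Asymptotics.isLittleO_iff.mp h2) (show (0 : ℝ) < 3 * δ / C by positivity),
    (Asymptotics.isLittleO_iff.mp h3) (show (0 : ℝ) < 1 / (2 * (1 / 8 + Real.log 2 / 6 + δ)) by
      positivity)] with N hN hD hLL1 hL0 b1 b2 b3
  simp only [Real.norm_eq_abs] at b1 b2 b3
  rw [abs_of_nonneg (by positivity), abs_of_nonneg hL0] at b1
  rw [abs_of_nonneg (by linarith), abs_of_nonneg hL0] at b2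
  rw [abs_of_nonneg hL0, abs_of_nonneg (Nat.cast_nonneg N)] at b3
  refine ⟨hN, hD, hLL1, b1, ?_, ?_⟩
  · have := mul_le_mul_of_nonneg_left b2 hC.le
    have e : C * (3 * δ / C * Real.log N) = 3 * δ * Real.log N := by field_simp
    linarith
  · have := mul_le_mul_of_nonneg_left b3 hc3.le
    have e : (1 / 8 + Real.log 2 / 6 + δ) * (1 / (2 * (1 / 8 + Real.log 2 / 6 + δ)) * (N : ℝ)) =
        (N : ℝ) / 2 := by field_simp
    linarith

/-! ### 5. Prop. 10.8 (iii), discharged -/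
/-- **von Känel–Matschke, Prop. 10.8 (iii) — PROVED**: for every `δ > 0` there is `N₀` with
`β ≤ (1/8) ν log N + ((1/6) log 2 + δ)/(log log N) · ν log N` for all `N ≥ N₀` (Wigert's bound in
the proof of (ii)). Discharges the named fact `vonKanelMatschke_prop_10_8_iii`.
[cite: VonkanelMatschke2023, Prop. 10.8 (iii) (arXiv §10.5.2, prop:explbounds; proof §10.5.3)] -/
theorem vonKanelMatschke_prop_10_8_iii_holds : vonKanelMatschke_prop_10_8_iii := by
  intro δ hδ
  -- Wigert with `ε = min δ 1`
  set ε := min δ 1 with hε'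
  have hε : 0 < ε := lt_min hδ one_pos
  have hε1 : ε ≤ 1 := min_le_right _ _
  have hεδ : ε ≤ δ := min_le_left _ _
  obtain ⟨l₀, hl₀16, hW⟩ := exists_log_card_divisors_le_uniform hε
  have hlog2 : 0 < Real.log 2 := Real.log_pos (by norm_num)
  have hlog2' := Real.log_two_lt_d9
  set A := (1 + ε) * Real.log 2 with hA'
  have hA0 : 0 ≤ A := by positivity
  have hA6 : A / 6 ≤ Real.log 2 / 6 + δ / 2 := by rw [hA']; nlinarith
  set K := A + Real.log l₀ with hK'
  have hl₀' : (1 : ℝ) ≤ l₀ := by exact_mod_cast le_trans (by norm_num) hl₀16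
  have hK0 : 0 ≤ K := by have := Real.log_nonneg hl₀'; positivity
  obtain ⟨N₀, hN₀⟩ := Filter.eventually_atTop.mp
    (eventually_aux (D := 2 * (l₀ : ℝ)) hδ (show 0 < K + 12 by positivity))
  refine ⟨N₀, fun N hN ↦ ?_⟩
  obtain ⟨h11, hD, hLL1, hsq, hlin, hlin3⟩ := hN₀ N hN
  have hN2 : 2 ≤ N := by omega
  have hN' : (11 : ℝ) ≤ N := by exact_mod_cast h11
  -- `ν`, `L = log N`, `L₂ = log log N`, `W = L/L₂`
  have hνN : condNu N ≤ N := condNu_le_self N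
  have hν2 : (N : ℝ) / 2 ≤ condNu N := half_le_condNu (by omega)
  have hν0 : 0 ≤ condNu N := by linarith
  have hLpos : 0 < Real.log N := Real.log_pos (by linarith)
  have hL0 : 0 ≤ Real.log N := hLpos.le
  have hL2pos : 0 < Real.log (Real.log N) := by linarith
  have hLe : Real.exp 1 ≤ Real.log N := (Real.le_log_iff_exp_le hLpos).mp hLL1
  have hW0 : 0 ≤ Real.log N / Real.log (Real.log N) := by positivity
  have hWL : Real.log N / Real.log (Real.log N) ≤ Real.log N := div_le_self hL0 hLL1
  rcases Nat.eq_zero_or_pos (newformCount N) with hm | hm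
  · -- `m = 0`: `β = 0`
    have hl1 : 1 ≤ vkmIndexL N := one_le_vkmIndexL hN2
    have hβ : vkmBeta N ≤ 0 := by
      have h := maxLogTauSum_le hl1 (newformCount N)
      unfold vkmBeta
      rw [hm] at h ⊢
      simp only [Nat.cast_zero, zero_mul, mul_zero, zero_add] at h ⊢
      exact h
    have hpos : 0 ≤ 1 / 8 * condNu N * Real.log N +
        (1 / 6 * Real.log 2 + δ) / Real.log (Real.log N) * (condNu N * Real.log N) := by positivity
    linarith
  · -- `m ≥ 1`
    have hm1 : (1 : ℝ) ≤ newformCount N := by exact_mod_cast hm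
    have hm0 : (0 : ℝ) ≤ newformCount N := by linarith
    have hmle := twelve_mul_newformCount_le hN2
    -- `l ≥ l₀ ≥ 16`
    have hl : l₀ ≤ vkmIndexL N := by
      have h1 := half_le_vkmIndexL hN2
      have h2 : 2 * l₀ ≤ N := by exact_mod_cast hD
      omega
    have hl1 : 1 ≤ vkmIndexL N := le_trans (by omega) hl
    have hlpos : (0 : ℝ) < vkmIndexL N := by exact_mod_cast hl1
    have hl16 : (16 : ℝ) ≤ vkmIndexL N := by exact_mod_cast hl₀16.trans hl
    have hlogl : Real.exp 1 ≤ Real.log (vkmIndexL N) := exp_one_le_log hl16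
    have he := Real.exp_one_gt_d9
    have hll : 0 < Real.log (Real.log (vkmIndexL N)) := Real.log_pos (by linarith)
    -- Wigert on `[1, l]`: `log τ(j) ≤ T`
    have hT0 : 0 ≤ (1 + ε) * Real.log 2 * Real.log (vkmIndexL N) / Real.log (Real.log (vkmIndexL N)) +
        Real.log l₀ := by
      have := Real.log_nonneg hl₀'; positivity
    have hS := maxLogTauSum_le_of_log_card_divisors_le hl1 hT0 (hW _ hl) (newformCount N)
    have hβ : vkmBeta N ≤ 1 / 2 * (newformCount N : ℝ) * Real.log (newformCount N) +
        (newformCount N : ℝ) * ((1 + ε) * Real.log 2 * Real.log (vkmIndexL N) /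
          Real.log (Real.log (vkmIndexL N)) + Real.log l₀ + 1 / 2 * Real.log (vkmIndexL N)) := by
      unfold vkmBeta; linarith
    -- `log m ≤ log N`
    have hlogm : Real.log (newformCount N : ℝ) ≤ Real.log N :=
      Real.log_le_log (by linarith) (by linarith)
    -- `log l ≤ U = 2 L + L₂` and `log l / log log l ≤ U / log U ≤ U / L₂ = 2 W + 1`
    have hU := log_vkmIndexL_le h11
    have hmono := div_log_mono hlogl hU
    have hlogU : Real.log (Real.log N) ≤ Real.log (2 * Real.log N + Real.log (Real.log N)) :=
      Real.log_le_log hLpos (by linarith)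
    have hU0 : 0 ≤ 2 * Real.log N + Real.log (Real.log N) := by linarith
    have hdiv : (2 * Real.log N + Real.log (Real.log N)) /
          Real.log (2 * Real.log N + Real.log (Real.log N)) ≤
        (2 * Real.log N + Real.log (Real.log N)) / Real.log (Real.log N) :=
      div_le_div_of_nonneg_left hU0 hL2pos hlogU
    have hW' : (2 * Real.log N + Real.log (Real.log N)) / Real.log (Real.log N) =
        2 * (Real.log N / Real.log (Real.log N)) + 1 := by
      field_simp
    have hratio : Real.log (vkmIndexL N) / Real.log (Real.log (vkmIndexL N)) ≤
        2 * (Real.log N / Real.log (Real.log N)) + 1 := by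
      rw [← hW']; exact hmono.trans hdiv
    have hT : (1 + ε) * Real.log 2 * Real.log (vkmIndexL N) / Real.log (Real.log (vkmIndexL N)) ≤
        A * (2 * (Real.log N / Real.log (Real.log N)) + 1) := by
      rw [hA', mul_div_assoc]
      exact mul_le_mul_of_nonneg_left hratio (by positivity)
    -- the bracket `Y = (3/2) L + ½ L₂ + 2 A W + K ≥ 0`
    have hX : 1 / 2 * Real.log (newformCount N : ℝ) +
        ((1 + ε) * Real.log 2 * Real.log (vkmIndexL N) / Real.log (Real.log (vkmIndexL N)) +
          Real.log l₀ + 1 / 2 * Real.log (vkmIndexL N)) ≤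
        3 / 2 * Real.log N + 1 / 2 * Real.log (Real.log N) +
          2 * A * (Real.log N / Real.log (Real.log N)) + K := by
      rw [hK']; linarith
    have hY0 : 0 ≤ 3 / 2 * Real.log N + 1 / 2 * Real.log (Real.log N) +
        2 * A * (Real.log N / Real.log (Real.log N)) + K := by positivity
    have hβ2 : vkmBeta N ≤ (newformCount N : ℝ) * (3 / 2 * Real.log N + 1 / 2 * Real.log (Real.log N) +
        2 * A * (Real.log N / Real.log (Real.log N)) + K) := by
      have h := mul_le_mul_of_nonneg_left hX hm0
      have e : (newformCount N : ℝ) * (1 / 2 * Real.log (newformCount N : ℝ) +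
          ((1 + ε) * Real.log 2 * Real.log (vkmIndexL N) / Real.log (Real.log (vkmIndexL N)) +
            Real.log l₀ + 1 / 2 * Real.log (vkmIndexL N))) =
          1 / 2 * (newformCount N : ℝ) * Real.log (newformCount N) +
            (newformCount N : ℝ) * ((1 + ε) * Real.log 2 * Real.log (vkmIndexL N) /
              Real.log (Real.log (vkmIndexL N)) + Real.log l₀ + 1 / 2 * Real.log (vkmIndexL N)) := by
        ring
      linarith
    have hβ3 : vkmBeta N ≤ (condNu N + 1) / 12 * (3 / 2 * Real.log N + 1 / 2 * Real.log (Real.log N) +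
        2 * A * (Real.log N / Real.log (Real.log N)) + K) :=
      hβ2.trans (mul_le_mul_of_nonneg_right (by linarith) hY0)
    -- bookkeeping
    have e1 : (condNu N + 1) / 12 * (3 / 2 * Real.log N + 1 / 2 * Real.log (Real.log N) +
        2 * A * (Real.log N / Real.log (Real.log N)) + K) =
        1 / 8 * condNu N * Real.log N + 1 / 8 * Real.log N +
          (condNu N + 1) * Real.log (Real.log N) / 24 +
          A / 6 * ((condNu N + 1) * (Real.log N / Real.log (Real.log N))) +
          (condNu N + 1) * K / 12 := by ring
    rw [e1] at hβ3
    have g1 : A / 6 * ((condNu N + 1) * (Real.log N / Real.log (Real.log N))) ≤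
        (Real.log 2 / 6 + δ / 2) * ((condNu N + 1) * (Real.log N / Real.log (Real.log N))) :=
      mul_le_mul_of_nonneg_right hA6 (by positivity)
    have c1 : Real.log (Real.log N) ≤ 6 * δ * (Real.log N / Real.log (Real.log N)) := by
      rw [mul_div_assoc', le_div_iff₀ hL2pos, ← sq]
      exact hsq
    have c1' : (condNu N + 1) * Real.log (Real.log N) ≤
        (condNu N + 1) * (6 * δ * (Real.log N / Real.log (Real.log N))) :=
      mul_le_mul_of_nonneg_left c1 (by positivity)
    have c2 : K + 12 ≤ 3 * δ * (Real.log N / Real.log (Real.log N)) := by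
      rw [mul_div_assoc', le_div_iff₀ hL2pos]
      exact hlin
    have c2' : (condNu N + 1) * (K + 12) ≤
        (condNu N + 1) * (3 * δ * (Real.log N / Real.log (Real.log N))) :=
      mul_le_mul_of_nonneg_left c2 (by positivity)
    have h3 : (Real.log 2 / 6 + δ) * (Real.log N / Real.log (Real.log N)) ≤
        (Real.log 2 / 6 + δ) * Real.log N :=
      mul_le_mul_of_nonneg_left hWL (by positivity)
    have e2 : 1 / 8 * condNu N * Real.log N +
        (1 / 6 * Real.log 2 + δ) / Real.log (Real.log N) * (condNu N * Real.log N) =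
        1 / 8 * condNu N * Real.log N +
          (Real.log 2 / 6 + δ) * (condNu N * (Real.log N / Real.log (Real.log N))) := by ring
    rw [e2]
    linarith [hβ3, g1, c1', c2', h3, hlin3, hν2]

/-- **The asymptotic (eq:szpiro) from modularity and Prop. 10.8 (i) alone**:
`log Δ_E ≤ (3/4) ν log N + ((log 2 + o(1))/log log N) ν log N` (`log_minimalDiscriminant_le_asymptotic_of_prop_10_8`
of `HeightConductorBoundsModularityAsymptoticProofs` with (iii) discharged).
[cite: VonkanelMatschke2023, §10.5.3 display after (eq:szpiro)] -/
theorem log_minimalDiscriminant_le_asymptotic_of_prop_10_8_i (hmod : nonempty_modularParametrizationData)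
    (hi : vonKanelMatschke_prop_10_8_i) : vonKanelMatschke_log_minimalDiscriminant_le_asymptotic :=
  log_minimalDiscriminant_le_asymptotic_of_prop_10_8 hmod hi vonKanelMatschke_prop_10_8_iii_holds

end Literature.NumberTheory.EllipticCurves.ModularForms
end
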